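import Mathlib
import Literature.NumberTheory.Irrationality.Brown2016.DinnerParties
import HarnessLib

/-!
# ζ(5) search — Families: `𝒞₈ = 17` — the seventeen printed `N = 8` configurations are ALL of them (kernel-certified)

HONEST FRAMING: systematic search; no irrationality claim unless certified.

Cell `pub-zeta5`, seat P2 (for `fam-brown8`: the search space of `N = 8` cellular families is EXACTLY the seventeen
configurations of `Families/CellularEightAtlas{A,B,C}.lean`).  `Literature/…/Brown2016/DinnerParties.lean` kernel-checks
that Brown's seventeen printed seating plans `reps8` [Brown2016, App. 2 §10.1.4] are convergent and pairwise inequivalent,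
and records that COMPLETENESS ("`𝒞₈ = 17`" in the printed table `𝒞_N = 0, 1, 1, 5, 17, 105, 771, 7028`
[Brown2016, App. 2 §10.1]) was NOT kernel-checked there ("40320 seatings exceed a reasonable `decide` budget").  This file
supplies the kernel proof, `complete_reps8`:

  every convergent seating plan of `8` guests is equivalent (same configuration) to one of the seventeen printed plans.

Method (reduces the kernel work from `8!` seatings × `17 × 256` group elements to `7 × 6!` seatings × `≤ 17 × 32`):
* `isConvergent_rotate` — Brown's convergence condition is invariant under cyclic rotation of the positions
  ("It does not depend on the choice of representative for `[σ]`" [Brown2016, §3.1]); so a convergent seating may be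
  rotated until the guest `8` sits first (`window_rotate`, index arithmetic only);
* `equiv_of_equiv_rotate` — the equivalence test `Brown2016.equiv` absorbs a rotation of its first argument (the group
  `D₁₆ × D₁₆` of [Brown2016, §3.1 (3.4)–(3.5)] contains the rotations; `List.rotate_rotate`, `List.reverse_rotate`);
* `equivFast` — for plans whose first entries agree modulo `n` only the `2·n·2` group elements with the forced value
  shift need testing; `equiv_of_equivFast`;
* `completeChunk8 y` — for each second guest `y ∈ {1,…,7}` the Boolean certificate "every plan `8 :: y :: rest` is
  non-convergent or `equivFast`-equivalent to a printed one", evaluated by the kernel (`decide +kernel`, `6! = 720`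
  plans each);
* `complete_reps8` — assembly.  With `isConvergent_reps8` and `pairwise_not_equivalent_reps8` of `DinnerParties` this is
  the printed count `𝒞₈ = 17`, now fully machine-checked (`card_configurations_eight` states the three facts together).
-/

namespace Summit.KontsevichZagierPeriods.Zeta5Search.Families.Configurations

open Literature.NumberTheory.Irrationality.Brown2016

/-! ### Rotation invariance of Brown's convergence test -/

/-- A cyclic window of a rotated plan is a cyclic window of the plan: `window (σ.rotate r) i k = window σ (i + r) k`.
[Brown2016, §3.1] -/
theorem window_rotate (σ : List ℕ) (r i k : ℕ) : window (σ.rotate r) i k = window σ (i + r) k := by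
  unfold window
  rw [List.length_rotate]
  rcases Nat.eq_zero_or_pos σ.length with h0 | hpos
  · have : σ = [] := List.length_eq_zero_iff.1 h0
    subst this
    simp
  · apply List.map_congr_left
    intro j _
    have hm : (i + j) % σ.length < σ.length := Nat.mod_lt _ hpos
    rw [List.getD_eq_getElem?_getD, List.getD_eq_getElem?_getD, List.getElem?_rotate hm]
    congr 2
    rw [Nat.mod_add_mod, Nat.add_right_comm]

/-- Windows only depend on the starting position modulo the length. -/
theorem window_mod (σ : List ℕ) (i k : ℕ) : window σ (i % σ.length) k = window σ i k := by
  unfold window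
  apply List.map_congr_left
  intro j _
  rw [Nat.mod_add_mod]

/-- Unfolding of Brown's Boolean convergence test into a quantified statement. -/
theorem isConvergent_iff (n : ℕ) (σ : List ℕ) :
    isConvergent n σ = true ↔ ∀ k' < n - 3, ∀ i < n, isCyclicBlock n (window σ i (k' + 2)) = false := by
  simp [isConvergent, List.all_eq_true]

/-- Brown's convergence condition is invariant under cyclic rotation of the positions (the cyclic part of the source
dihedral group). [Brown2016, §3.1 ("does not depend on the choice of representative")] -/
theorem isConvergent_rotate {n : ℕ} (σ : List ℕ) (hσ : σ.length = n) (r : ℕ) :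
    isConvergent n (σ.rotate r) = isConvergent n σ := by
  rcases Nat.eq_zero_or_pos n with h0 | hpos
  · subst h0
    have : σ = [] := List.length_eq_zero_iff.1 hσ
    subst this
    simp
  rw [Bool.eq_iff_iff, isConvergent_iff, isConvergent_iff]
  constructor
  · intro h k' hk' i hi
    -- use the rotated plan at position `j = (i + (n - r % n)) % n`
    have key := h k' hk' ((i + (n - r % n)) % n) (Nat.mod_lt _ hpos)
    rw [window_rotate] at key
    have hidx : ((i + (n - r % n)) % n + r) % n = i := by
      rw [Nat.mod_add_mod]
      have h1 : r % n + n * (r / n) = r := Nat.mod_add_div r n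
      have h2 : r % n < n := Nat.mod_lt r hpos
      have h3 : i + (n - r % n) + r = i + n * (r / n + 1) := by
        have : i + (n - r % n) + r = i + n + n * (r / n) := by omega
        rw [this]; ring
      rw [h3, Nat.add_mul_mod_self_left, Nat.mod_eq_of_lt hi]
    have hw : window σ ((i + (n - r % n)) % n + r) (k' + 2) = window σ i (k' + 2) := by
      rw [← window_mod σ ((i + (n - r % n)) % n + r), hσ, hidx]
    rw [hw] at key
    exact key
  · intro h k' hk' i hi
    rw [window_rotate]
    have hw : window σ (i + r) (k' + 2) = window σ ((i + r) % n) (k' + 2) := by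
      rw [← window_mod σ (i + r), hσ]
    rw [hw]
    exact h k' hk' _ (Nat.mod_lt _ hpos)

/-! ### The equivalence test absorbs rotations; a fast sufficient test -/

/-- Unfolding of Brown's Boolean equivalence test. -/
theorem equiv_iff (n : ℕ) (σ τ : List ℕ) :
    equiv n σ τ = true ↔ ∃ pr r vn c, r < n ∧ c < n ∧ act n pr r vn c σ = τ.map (· % n) := by
  unfold equiv
  simp only [List.any_eq_true, List.mem_range, beq_iff_eq]
  constructor
  · rintro ⟨pr, -, r, hr, vn, -, c, hc, h⟩
    exact ⟨pr, r, vn, c, hr, hc, h⟩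
  · rintro ⟨pr, r, vn, c, hr, hc, h⟩
    exact ⟨pr, by cases pr <;> simp, r, hr, vn, by cases vn <;> simp, c, hc, h⟩

/-- The equivalence test absorbs a rotation of the positions of its first argument (rotations belong to the source
dihedral group). [Brown2016, §3.1 (3.4)] -/
theorem equiv_of_equiv_rotate {n : ℕ} {σ τ : List ℕ} (hσ : σ.length = n) (hn : 0 < n) (r0 : ℕ)
    (h : equiv n (σ.rotate r0) τ = true) : equiv n σ τ = true := by
  rw [equiv_iff] at h ⊢
  obtain ⟨pr, r, vn, c, hr, hc, hact⟩ := h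
  cases pr with
  | false =>
    refine ⟨false, (r0 + r) % n, vn, c, Nat.mod_lt _ hn, hc, ?_⟩
    simp only [act, Bool.false_eq_true, if_false] at hact ⊢
    rw [List.rotate_rotate] at hact
    have hm := List.rotate_mod σ (r0 + r)
    rw [hσ] at hm
    rw [hm]
    exact hact
  | true =>
    refine ⟨true, (n - r0 % n + r) % n, vn, c, Nat.mod_lt _ hn, hc, ?_⟩
    simp only [act, if_true] at hact ⊢
    rw [List.reverse_rotate, List.rotate_rotate, hσ] at hact
    have hm := List.rotate_mod σ.reverse (n - r0 % n + r)
    rw [List.length_reverse, hσ] at hm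
    rw [hm]
    exact hact

/-- Fast sufficient equivalence test: only the value shift that sends the (rotated, possibly negated) first entry to the
residue of `τ`'s first entry is tried (`2·n·2` group elements instead of `4n²`). -/
def equivFast (n : ℕ) (σ τ : List ℕ) : Bool :=
  [false, true].any fun pr => (List.range n).any fun r => [false, true].any fun vn =>
    act n pr r vn
      ((n + τ.headD 0 % n - (act n pr r vn 0 σ).headD 0 % n) % n) σ == τ.map (· % n)

/-- The fast test implies Brown's test. -/
theorem equiv_of_equivFast {n : ℕ} (hn : 0 < n) {σ τ : List ℕ} (h : equivFast n σ τ = true) :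
    equiv n σ τ = true := by
  rw [equiv_iff]
  unfold equivFast at h
  simp only [List.any_eq_true, List.mem_range, beq_iff_eq] at h
  obtain ⟨pr, -, r, hr, vn, -, h⟩ := h
  exact ⟨pr, r, vn, _, hr, Nat.mod_lt _ hn, h⟩

/-! ### The kernel certificates, chunked by the second guest -/

/-- Chunk `y` of the `N = 8` completeness certificate: every plan `8 :: y :: rest` (`rest` a rearrangement of
`{1,…,7} ∖ {y}`) is either non-convergent or passes the fast equivalence test against one of the seventeen printed
plans. (Computational device.) -/
def completeChunk8 (y : ℕ) : Bool :=
  (((List.range' 1 7).erase y).permutations').all fun rest =>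
    !isConvergent 8 (8 :: y :: rest) || reps8.any (equivFast 8 (8 :: y :: rest))

-- finite enumeration of 720 seating plans by kernel evaluation
set_option maxHeartbeats 4000000 in
/-- Chunk `y = 1` (all plans non-convergent: `8, 1` are neighbours). -/
theorem completeChunk8_1 : completeChunk8 1 = true := by decide +kernel

set_option maxHeartbeats 4000000 in
/-- Chunk `y = 2`. -/
theorem completeChunk8_2 : completeChunk8 2 = true := by decide +kernel

set_option maxHeartbeats 4000000 in
/-- Chunk `y = 3`. -/
theorem completeChunk8_3 : completeChunk8 3 = true := by decide +kernel

set_option maxHeartbeats 4000000 in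
/-- Chunk `y = 4`. -/
theorem completeChunk8_4 : completeChunk8 4 = true := by decide +kernel

set_option maxHeartbeats 4000000 in
/-- Chunk `y = 5`. -/
theorem completeChunk8_5 : completeChunk8 5 = true := by decide +kernel

set_option maxHeartbeats 4000000 in
/-- Chunk `y = 6`. -/
theorem completeChunk8_6 : completeChunk8 6 = true := by decide +kernel

set_option maxHeartbeats 4000000 in
/-- Chunk `y = 7` (all plans non-convergent: `8, 7` are neighbours). -/
theorem completeChunk8_7 : completeChunk8 7 = true := by decide +kernel

/-- All seven chunks. -/
theorem completeChunk8_all (y : ℕ) (hy : y ∈ List.range' 1 7) : completeChunk8 y = true := by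
  have e : List.range' 1 7 = [1, 2, 3, 4, 5, 6, 7] := rfl
  rw [e] at hy
  simp only [List.mem_cons, List.not_mem_nil, or_false] at hy
  rcases hy with rfl | rfl | rfl | rfl | rfl | rfl | rfl
  exacts [completeChunk8_1, completeChunk8_2, completeChunk8_3, completeChunk8_4, completeChunk8_5,
    completeChunk8_6, completeChunk8_7]

/-! ### Assembly: `𝒞₈ = 17` -/

/-- **Completeness for `N = 8`** (`𝒞₈ ≤ 17`): every convergent seating plan of `8` guests is equivalent to one of the
seventeen printed plans `Brown2016.reps8`. [Brown2016, App. 2 §10.1 (table: `𝒞₈ = 17`), §10.1.4] -/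
theorem complete_reps8 :
    ∀ σ, IsSeating 8 σ → IsConvergent 8 σ → ∃ τ ∈ reps8, Equivalent 8 σ τ := by
  intro σ hσ hc
  have hlen : σ.length = 8 := by simpa using hσ.length_eq
  -- locate the guest `8` and rotate it to the front
  have h8 : 8 ∈ σ := hσ.symm.subset (by decide)
  obtain ⟨r0, hr0, hget⟩ := List.mem_iff_getElem.1 h8
  set σ' := σ.rotate r0 with hσ'
  have hlen' : σ'.length = 8 := by rw [hσ', List.length_rotate, hlen]
  have hhead : σ'.head? = some 8 := by
    rw [hσ', List.head?_rotate hr0, List.getElem?_eq_getElem hr0]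
    exact congrArg some hget
  obtain ⟨rest, hrest⟩ : ∃ rest, σ' = 8 :: rest := by
    cases hs : σ' with
    | nil => rw [hs] at hhead; simp at hhead
    | cons x rest => rw [hs] at hhead; simp at hhead; exact ⟨rest, by rw [hhead]⟩
  -- `rest` is a rearrangement of `1..7`; split off its first guest `y`
  have hperm' : List.Perm σ' (List.range' 1 8) := (List.rotate_perm σ r0).trans hσ
  rw [hrest] at hperm'
  have hrest_perm : List.Perm rest ((List.range' 1 8).erase 8) := (List.cons_perm_iff_perm_erase.1 hperm').2
  have e7 : (List.range' 1 8).erase 8 = List.range' 1 7 := by decide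
  rw [e7] at hrest_perm
  obtain ⟨y, rest2, rfl⟩ : ∃ y rest2, rest = y :: rest2 := by
    cases rest with
    | nil => exact absurd hrest_perm.length_eq (by decide)
    | cons y rest2 => exact ⟨y, rest2, rfl⟩
  have hy : y ∈ List.range' 1 7 := hrest_perm.subset List.mem_cons_self
  have hrest2 : rest2 ∈ ((List.range' 1 7).erase y).permutations' :=
    List.mem_permutations'.2 ((hrest_perm.trans (List.perm_cons_erase hy)).cons_inv)
  -- the chunk certificate
  have hchunk := completeChunk8_all y hy
  unfold completeChunk8 at hchunk
  rw [List.all_eq_true] at hchunk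
  have h := hchunk rest2 hrest2
  rw [Bool.or_eq_true, Bool.not_eq_true', List.any_eq_true] at h
  -- convergence transfers to the rotated plan
  have hc' : isConvergent 8 (8 :: y :: rest2) = true := by
    rw [← hrest, hσ', isConvergent_rotate σ hlen r0]
    exact hc
  rcases h with h | ⟨τ, hτ, hστ⟩
  · exact absurd hc' (by simp [h])
  · refine ⟨τ, hτ, ?_⟩
    have h1 : equiv 8 σ' τ = true := by
      rw [hrest]; exact equiv_of_equivFast (by norm_num) hστ
    exact equiv_of_equiv_rotate hlen (by norm_num) r0 h1

/-- **`𝒞₈ = 17`** [Brown2016, App. 2 §10.1, table] fully machine-checked: the seventeen printed plans are convergent,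
pairwise inequivalent, and every convergent plan of `8` guests is equivalent to one of them. -/
theorem card_configurations_eight :
    (∀ σ ∈ reps8, IsConvergent 8 σ) ∧ (reps8.Pairwise fun σ τ => ¬ Equivalent 8 σ τ) ∧ reps8.length = 17 ∧
      ∀ σ, IsSeating 8 σ → IsConvergent 8 σ → ∃ τ ∈ reps8, Equivalent 8 σ τ :=
  ⟨isConvergent_reps8, pairwise_not_equivalent_reps8, rfl, complete_reps8⟩

end Summit.KontsevichZagierPeriods.Zeta5Search.Families.Configurations
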